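import Mathlib.MeasureTheory.Integral.Bochner.ContinuousLinearMap
import Mathlib.MeasureTheory.Function.AEEqOfLIntegral
import Literature.Probability.Percolation.FlipFairKernel

/-!
# Flip-extremality forces flip-invariant bounded densities to be constant

Route `Summits/CriticalPhenomena/CardyFormulaZ2/Theses/CardyMeckeFlip`, crux `MeckeRigidity`
(item stmt-CriticalPhenomena-14826), line `registered`, stub `stub_crossingUniqueness` (helpers).

The abstract "extremal ⟹ ergodic" step for the flip axioms of the crux.  Let `P` be a probability
law on `ℋ_D` with kernel family `M`, flip-fair at every cutoff ((F), `IsFlipFairKernel P (M ε)`) and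
flip-extremal ((EXT), `IsFlipExtremal P M`: whenever two flip-fair probability laws average to `P`
they equal `P`).  If `h : ℋ_D → [0,1]` is measurable and *flip-invariant in the weak sense that the
tilted Campbell integrals still balance* — `∫ h(S)·L(S) dP = ∫ h(S)·R(S) dP` for every datum of (F),
`L`/`R` the un-toggled/toggled integrands, both in `L¹(P)` — then the two tilts
`P₁ = (1 + h − ∫h) P`, `P₂ = (1 − h + ∫h) P` are flip-fair probability laws with `P₁ + P₂ = 2P`
(`isFlipFairKernel_withDensity_of_integral_mul_eq`, the density calculus), so (EXT) gives `P₁ = P`,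
i.e. `h = ∫ h dP` almost surely (`ae_eq_const_of_isFlipExtremal`; registered `∀`-form
`flipExtremal_ae_eq_const_of_forall_integral_mul_eq`).  The companion files supply the densities
`h` to which this applies (limits of cylinder functions of far-away quads, whence Birkhoff limits
along translations): flip-extremal laws are spatially ergodic.
-/

noncomputable section

open MeasureTheory Set Filter Topology
open scoped ENNReal NNReal
open Literature.Probability.Percolation Literature.Probability.Percolation.QuadCrossing

namespace Summit.CriticalPhenomena.CardyFormulaZ2.Theorems.CardyMeckeFlip

variable {D : Set ℂ}

/-! ### Tilting a law by a density: the flip identity for `ρ · P` -/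

/-- Integration against the tilt `(ofReal ∘ ρ) · P` of `P` by a nonnegative measurable real density
is integration of `ρ · F` against `P` (for every `F`, integrable or not). [folklore] -/
theorem integral_withDensity_ofReal_eq {P : Measure (QuadConfig D)} {ρ : QuadConfig D → ℝ}
    (hρm : Measurable ρ) (hρ0 : ∀ S, 0 ≤ ρ S) (F : QuadConfig D → ℝ) :
    ∫ S, F S ∂(P.withDensity fun S => ENNReal.ofReal (ρ S)) = ∫ S, ρ S * F S ∂P := by
  have hmeas : Measurable fun S => (ρ S).toNNReal := hρm.real_toNNReal
  have key := integral_withDensity_eq_integral_smul (μ := P) hmeas F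
  simp only [NNReal.smul_def, Real.coe_toNNReal _ (hρ0 _), smul_eq_mul] at key
  exact key

/-- **Flip-fair tilts** (the density calculus for (F)): if a nonnegative measurable density `ρ`
balances the tilted Campbell integrals — `∫ ρ·L dP = ∫ ρ·R dP` for every datum of (F), `L`/`R` the
un-toggled/toggled integrands — then the law `ρ · P` is flip-fair for the same kernel. [folklore] -/
theorem isFlipFairKernel_withDensity_of_integral_mul_eq {P : Measure (QuadConfig D)}
    {K : QuadConfig D → Measure ℂ} {ρ : QuadConfig D → ℝ} (hρm : Measurable ρ) (hρ0 : ∀ S, 0 ≤ ρ S)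
    (h : ∀ (n : ℕ) (Q : Fin n → Quad D) (g : Set (Fin n) → ℝ) (φ : ℂ → ℝ), Continuous φ →
      HasCompactSupport φ →
        ∫ S, ρ S * ∫ x, φ x * g {i | Q i ∈ S} ∂(K S) ∂P =
          ∫ S, ρ S * ∫ x, φ x * g {i | Xor (Q i ∈ S) (S.IsPivotalAt x (Q i))} ∂(K S) ∂P) :
    IsFlipFairKernel (P.withDensity fun S => ENNReal.ofReal (ρ S)) K := by
  intro n Q g φ hφ hφc
  rw [integral_withDensity_ofReal_eq hρm hρ0, integral_withDensity_ofReal_eq hρm hρ0]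
  exact h n Q g φ hφ hφc

/-- The tilt of a probability law by a nonnegative integrable density of integral one is a
probability law. [folklore] -/
theorem isProbabilityMeasure_withDensity_ofReal {P : Measure (QuadConfig D)}
    {ρ : QuadConfig D → ℝ} (hρi : Integrable ρ P) (hρ0 : ∀ S, 0 ≤ ρ S) (hone : ∫ S, ρ S ∂P = 1) :
    IsProbabilityMeasure (P.withDensity fun S => ENNReal.ofReal (ρ S)) := by
  refine ⟨?_⟩
  rw [withDensity_apply _ MeasurableSet.univ, Measure.restrict_univ,
    ← ofReal_integral_eq_lintegral_ofReal hρi (Eventually.of_forall hρ0), hone, ENNReal.ofReal_one]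

/-! ### Extremality ⟹ constancy -/

/-- A measurable `[0,1]`-valued function on a probability space is integrable, with integral in
`[0,1]`. [folklore] -/
theorem integrable_of_mem_Icc (P : Measure (QuadConfig D)) [IsProbabilityMeasure P]
    {h : QuadConfig D → ℝ} (hhm : Measurable h) (hh : ∀ S, 0 ≤ h S ∧ h S ≤ 1) :
    Integrable h P ∧ 0 ≤ ∫ S, h S ∂P ∧ ∫ S, h S ∂P ≤ 1 := by
  have hint : Integrable h P := by
    refine Integrable.mono' (integrable_const (1 : ℝ)) hhm.aestronglyMeasurable
      (Eventually.of_forall fun S => ?_)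
    rw [Real.norm_eq_abs, abs_le]
    exact ⟨by linarith [(hh S).1], (hh S).2⟩
  refine ⟨hint, integral_nonneg fun S => (hh S).1, ?_⟩
  calc ∫ S, h S ∂P ≤ ∫ _, (1 : ℝ) ∂P := integral_mono hint (integrable_const 1) fun S => (hh S).2
    _ = 1 := by simp

/-- **Flip-extremality forces weakly flip-invariant bounded densities to be constant.**  Let `P`
be a flip-fair ((F) at every cutoff) and flip-extremal ((EXT)) probability law for the kernel family
`M`, and `h : ℋ_D → [0,1]` measurable such that for every cutoff `ε > 0` and every datum of (F) the
un-toggled and toggled integrands `L`, `R` are in `L¹(P)` and `∫ h·L dP = ∫ h·R dP`.  Then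
`h = ∫ h dP` almost surely: the tilts `(1 + h − ∫h)·P` and `(1 − h + ∫h)·P` are flip-fair probability
laws averaging to `P`. [folklore] -/
theorem ae_eq_const_of_isFlipExtremal {P : Measure (QuadConfig D)} [IsProbabilityMeasure P]
    {M : ℝ → QuadConfig D → Measure ℂ} (hF : ∀ ε : ℝ, 0 < ε → IsFlipFairKernel P (M ε))
    (hEXT : IsFlipExtremal P M) {h : QuadConfig D → ℝ} (hhm : Measurable h)
    (hh : ∀ S, 0 ≤ h S ∧ h S ≤ 1)
    (hint : ∀ ε : ℝ, 0 < ε → ∀ (n : ℕ) (Q : Fin n → Quad D) (g : Set (Fin n) → ℝ) (φ : ℂ → ℝ),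
      Continuous φ → HasCompactSupport φ →
        Integrable (fun S => ∫ x, φ x * g {i | Q i ∈ S} ∂(M ε S)) P ∧
        Integrable (fun S => ∫ x, φ x * g {i | Xor (Q i ∈ S) (S.IsPivotalAt x (Q i))} ∂(M ε S)) P ∧
        ∫ S, h S * ∫ x, φ x * g {i | Q i ∈ S} ∂(M ε S) ∂P =
          ∫ S, h S * ∫ x, φ x * g {i | Xor (Q i ∈ S) (S.IsPivotalAt x (Q i))} ∂(M ε S) ∂P) :
    h =ᵐ[P] fun _ => ∫ S, h S ∂P := by
  obtain ⟨hhi, hc0, hc1⟩ := integrable_of_mem_Icc P hhm hh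
  set c₀ : ℝ := ∫ S, h S ∂P with hc₀
  -- the two densities
  set ρ₁ : QuadConfig D → ℝ := fun S => 1 + h S - c₀ with hρ₁
  set ρ₂ : QuadConfig D → ℝ := fun S => 1 - h S + c₀ with hρ₂
  have hρ₁m : Measurable ρ₁ := (measurable_const.add hhm).sub measurable_const
  have hρ₂m : Measurable ρ₂ := (measurable_const.sub hhm).add measurable_const
  have hρ₁0 : ∀ S, 0 ≤ ρ₁ S := fun S => by simp only [hρ₁]; linarith [(hh S).1]
  have hρ₂0 : ∀ S, 0 ≤ ρ₂ S := fun S => by simp only [hρ₂]; linarith [(hh S).2]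
  have hρ₁i : Integrable ρ₁ P := ((integrable_const 1).add hhi).sub (integrable_const c₀)
  have hρ₂i : Integrable ρ₂ P := ((integrable_const 1).sub hhi).add (integrable_const c₀)
  have hρ₁one : ∫ S, ρ₁ S ∂P = 1 := by
    have e : ρ₁ = fun S => (1 - c₀) + h S := by funext S; simp only [hρ₁]; ring
    rw [e, integral_add (integrable_const (1 - c₀)) hhi, integral_const]
    simp [hc₀]
  have hρ₂one : ∫ S, ρ₂ S ∂P = 1 := by
    have e : ρ₂ = fun S => (1 + c₀) - h S := by funext S; simp only [hρ₂]; ring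
    rw [e, integral_sub (integrable_const (1 + c₀)) hhi, integral_const]
    simp [hc₀]
  -- the two tilted laws
  set P₁ : Measure (QuadConfig D) := P.withDensity fun S => ENNReal.ofReal (ρ₁ S) with hP₁
  set P₂ : Measure (QuadConfig D) := P.withDensity fun S => ENNReal.ofReal (ρ₂ S) with hP₂
  haveI : IsProbabilityMeasure P₁ := isProbabilityMeasure_withDensity_ofReal hρ₁i hρ₁0 hρ₁one
  haveI : IsProbabilityMeasure P₂ := isProbabilityMeasure_withDensity_ofReal hρ₂i hρ₂0 hρ₂one
  -- the tilted Campbell integrals balance: linearity + (F) + the hypothesis on `h`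
  have hbal : ∀ (a b : ℝ) (ε : ℝ), 0 < ε → ∀ (n : ℕ) (Q : Fin n → Quad D) (g : Set (Fin n) → ℝ)
      (φ : ℂ → ℝ), Continuous φ → HasCompactSupport φ →
        ∫ S, (a + b * h S) * ∫ x, φ x * g {i | Q i ∈ S} ∂(M ε S) ∂P =
          ∫ S, (a + b * h S) * ∫ x, φ x * g {i | Xor (Q i ∈ S) (S.IsPivotalAt x (Q i))} ∂(M ε S) ∂P := by
    intro a b ε hε n Q g φ hφ hφc
    obtain ⟨hL, hR, hhLR⟩ := hint ε hε n Q g φ hφ hφc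
    have hFε := hF ε hε n Q g φ hφ hφc
    have hbd : ∀ᵐ S ∂P, ‖h S‖ ≤ 1 := Eventually.of_forall fun S => by
      rw [Real.norm_eq_abs, abs_le]; exact ⟨by linarith [(hh S).1], (hh S).2⟩
    have hhL : Integrable (fun S => h S * ∫ x, φ x * g {i | Q i ∈ S} ∂(M ε S)) P :=
      hL.bdd_mul hhm.aestronglyMeasurable hbd
    have hhR : Integrable
        (fun S => h S * ∫ x, φ x * g {i | Xor (Q i ∈ S) (S.IsPivotalAt x (Q i))} ∂(M ε S)) P :=
      hR.bdd_mul hhm.aestronglyMeasurable hbd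
    have e1 : ∀ S, (a + b * h S) * ∫ x, φ x * g {i | Q i ∈ S} ∂(M ε S) =
        a * (∫ x, φ x * g {i | Q i ∈ S} ∂(M ε S)) +
          b * (h S * ∫ x, φ x * g {i | Q i ∈ S} ∂(M ε S)) := fun S => by ring
    have e2 : ∀ S, (a + b * h S) * ∫ x, φ x * g {i | Xor (Q i ∈ S) (S.IsPivotalAt x (Q i))} ∂(M ε S) =
        a * (∫ x, φ x * g {i | Xor (Q i ∈ S) (S.IsPivotalAt x (Q i))} ∂(M ε S)) +
          b * (h S * ∫ x, φ x * g {i | Xor (Q i ∈ S) (S.IsPivotalAt x (Q i))} ∂(M ε S)) :=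
      fun S => by ring
    simp_rw [e1, e2]
    rw [integral_add (hL.const_mul a) (hhL.const_mul b), integral_add (hR.const_mul a) (hhR.const_mul b),
      integral_const_mul, integral_const_mul, integral_const_mul, integral_const_mul, hFε, hhLR]
  have hff₁ : ∀ ε : ℝ, 0 < ε → IsFlipFairKernel P₁ (M ε) := by
    intro ε hε
    refine isFlipFairKernel_withDensity_of_integral_mul_eq hρ₁m hρ₁0 fun n Q g φ hφ hφc => ?_
    have := hbal (1 - c₀) 1 ε hε n Q g φ hφ hφc
    simp only [one_mul] at this
    have e : ∀ S, ρ₁ S = 1 - c₀ + h S := fun S => by simp only [hρ₁]; ring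
    simp_rw [e]
    exact this
  have hff₂ : ∀ ε : ℝ, 0 < ε → IsFlipFairKernel P₂ (M ε) := by
    intro ε hε
    refine isFlipFairKernel_withDensity_of_integral_mul_eq hρ₂m hρ₂0 fun n Q g φ hφ hφc => ?_
    have := hbal (1 + c₀) (-1) ε hε n Q g φ hφ hφc
    have e : ∀ S, ρ₂ S = 1 + c₀ + (-1) * h S := fun S => by simp only [hρ₂]; ring
    simp_rw [e]
    exact this
  -- the two tilts average to `P`
  have hsum : P₁ + P₂ = P + P := by
    have hadd : (fun S => ENNReal.ofReal (ρ₁ S)) + (fun S => ENNReal.ofReal (ρ₂ S)) =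
        fun _ => (2 : ℝ≥0∞) := by
      funext S
      simp only [Pi.add_apply]
      rw [← ENNReal.ofReal_add (hρ₁0 S) (hρ₂0 S)]
      have : ρ₁ S + ρ₂ S = 2 := by simp only [hρ₁, hρ₂]; ring
      rw [this, ENNReal.ofReal_ofNat]
    rw [hP₁, hP₂, ← withDensity_add_left (hρ₁m.ennreal_ofReal) _, hadd, withDensity_const, two_smul]
  -- extremality: `P₁ = P`, i.e. `ρ₁ = 1` a.s., i.e. `h = c₀` a.s.
  have hP₁eq : P₁ = P := hEXT P₁ P₂ inferInstance inferInstance hff₁ hff₂ hsum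
  have hae : (fun S => ENNReal.ofReal (ρ₁ S)) =ᵐ[P] fun _ => (1 : ℝ≥0∞) := by
    have h1 : P.withDensity (fun S => ENNReal.ofReal (ρ₁ S)) = P.withDensity fun _ => 1 := by
      rw [← hP₁, hP₁eq]
      exact (withDensity_one).symm
    refine (withDensity_eq_iff hρ₁m.ennreal_ofReal.aemeasurable aemeasurable_const ?_).1 h1
    rw [← ofReal_integral_eq_lintegral_ofReal hρ₁i (Eventually.of_forall hρ₁0)]
    exact ENNReal.ofReal_ne_top
  filter_upwards [hae] with S hS
  have hS' : ρ₁ S = 1 := by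
    have := congrArg ENNReal.toReal hS
    rwa [ENNReal.toReal_ofReal (hρ₁0 S), ENNReal.toReal_one] at this
  simp only [hρ₁] at hS'
  show h S = c₀
  linarith

/-- **Registered form** (sub-goal `flipExtremal_ae_eq_const_of_forall_integral_mul_eq` of item
stmt-CriticalPhenomena-14826): for a flip-fair, flip-extremal probability law, every measurable
`[0,1]`-valued density whose tilted Campbell integrals balance (with both integrands in `L¹`) is
a.s. equal to its mean. [folklore] -/
theorem flipExtremal_ae_eq_const_of_forall_integral_mul_eq : ∀ (D : Set ℂ) (P : Measure (QuadConfig D)) (M : ℝ → QuadConfig D → Measure ℂ), IsProbabilityMeasure P → (∀ ε : ℝ, 0 < ε → IsFlipFairKernel P (M ε)) → IsFlipExtremal P M → ∀ (h : QuadConfig D → ℝ), Measurable h → (∀ S, 0 ≤ h S ∧ h S ≤ 1) → (∀ ε : ℝ, 0 < ε → ∀ (n : ℕ) (Q : Fin n → Quad D) (g : Set (Fin n) → ℝ) (φ : ℂ → ℝ), Continuous φ → HasCompactSupport φ → Integrable (fun S => ∫ x, φ x * g {i | Q i ∈ S} ∂(M ε S)) P ∧ Integrable (fun S => ∫ x,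 φ x * g {i | Xor (Q i ∈ S) (S.IsPivotalAt x (Q i))} ∂(M ε S)) P ∧ ∫ S, h S * ∫ x, φ x * g {i | Q i ∈ S} ∂(M ε S) ∂P = ∫ S, h S * ∫ x, φ x * g {i | Xor (Q i ∈ S) (S.IsPivotalAt x (Q i))} ∂(M ε S) ∂P) → h =ᵐ[P] fun _ => ∫ S, h S ∂P := by
  intro D P M hP hF hEXT h hhm hh hint
  exact ae_eq_const_of_isFlipExtremal hF hEXT hhm hh hint

end Summit.CriticalPhenomena.CardyFormulaZ2.Theorems.CardyMeckeFlip

end
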